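import Summits.NavierStokesRegularity.NavierStokesRegularity.Theorems.StrainDoorsFineStructure
import Summits.NavierStokesRegularity.NavierStokesRegularity.Theorems.StrainDoorsViscousCompositions
import Summits.NavierStokesRegularity.NavierStokesRegularity.Theorems.StrainDoorsCompositionsB
import HarnessLib

/-!
# StrainDoorsSaturation — the SATURATION LAW behind doors D8/D8′/D9 (ROUND-47 (2/3), nsreg-p1 g34)

At a critical point `x` of the strain form `y ↦ ⟪∇u(t,y)e,e⟫` (`‖e‖ = 1`; every exact strain maximiser is one) the
three closed plates E1_S⁺ `strainGrowthViscous_holds` (Riccati law with the viscous term KEPT), F_S `strainFrame_holds`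
(the momentum equation differentiated along `e`) and R `localNewtonSplits_holds` (`strainFeed = newtonNearFeed − smoothingTerm`)
give, for every pair of scales `0 < r₀ < r₁` and with NO hypothesis on the blow-up:

  `⟪∂ₜ(∇u e)(t,x), e⟫ + smoothingTerm r₀ r₁ p t x e − ν·strainLap u t x e ≤ newtonNearFeed r₀ r₁ u t x e − ⟪∇u(t,x)e,e⟫²`   (SAT)

(`saturation_law`).  Read at an exact strain maximiser (`strainLap ≤ 0`, `strainLap_nonpos_of_isStrainArgmax`): the D8
hypothesis «`newtonNearFeed ≤ λ²`» ((★) of R46 in fine-structure form, `newtonNearFeed_eq_fineStructureFeed`) FORCES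
`⟪∂ₜ(∇u e), e⟫ ≤ −smoothingTerm + ν·strainLap ≤ |smoothingTerm|` — it is the local, static form of «the strain maximum grows at
most at the energy-budgeted far-field rate».  For a STEADY solution (`u s = u s'` on `[0,T)`, so `∂ₜ(∇u e) = 0`, `timeDerivWithin_fderiv_eq_zero_of_steady`):

  `smoothingTerm − ν·strainLap ≤ newtonNearFeed − λ²`  (`saturation_of_steady`), so (★) at a steady exact maximiser forces
  `smoothingTerm ≤ ν·strainLap ≤ 0` (`smoothingTerm_le_of_steady_parity`), and (★) FAILS wherever `ν·strainLap < smoothingTerm`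
  (`not_parity_of_steady`): no steady-structure «depletion» can supply (★); at a steady maximiser it needs the FAR field to
  compress by at least the viscous diffusion `ν|Δ_y⟪S(y)e,e⟫|` of the strain form.

Quantitative face (numerics, not Lean): at the strain argmax of the Burgers vortex `ν|strainLap| = α(λ_max + α/2)` exactly and
(★) fails for every outer scale `r₁ ≳ 5.5 r_c` by `F/λ² ≈ α/λ_max` (`r47/RESULTS-burgers.md`, kit j321486).
HONEST FRAME: identities/inequalities valid for every classical solution; nothing here is a statement about blow-up; 0056
`NoTypeII` / NS regularity NOT touched.
-/

noncomputable section

open MeasureTheory Set Function Filter Metric Real InnerProductSpace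
open _root_.Topology
open scoped ENNReal NNReal RealInnerProductSpace ContDiff Laplacian
open Literature.Analysis Literature.Analysis.FluidPDE

set_option linter.dupNamespace false

namespace Summit.NavierStokesRegularity.NavierStokesRegularity.Theorems.StrainDoors

/-! ## §18 The saturation law (every classical solution, every critical point of the strain form) -/

/-- ★ **SATURATION LAW** (SAT).  For a classical solution on `[0,T)`, `t ∈ [0,T)`, scales `0 < r₀ < r₁`, a unit direction `e` and a
CRITICAL point `x` of `y ↦ ⟪∇u(t,y)e,e⟫`:
`⟪∂ₜ(∇u e)(t,x), e⟫ + smoothingTerm − ν·strainLap ≤ newtonNearFeed − ⟪∇u(t,x)e,e⟫²`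
(E1_S⁺ + F_S + R; the slack is exactly the matrix step `|S e|² ≥ ⟪Se,e⟫²`, zero when `e` is an eigenvector of `S(t,x)`). -/
theorem saturation_law {ν T : ℝ} {u : ℝ → (EuclideanSpace ℝ (Fin 3)) → (EuclideanSpace ℝ (Fin 3))}
    {p : ℝ → (EuclideanSpace ℝ (Fin 3)) → ℝ} (hν : 0 < ν) (hT : 0 < T)
    (hsol : IsClassicalNSSolutionOn (Ico 0 T) ν 0 u p) (hreg : ∀ T'' < T, HasBoundedSobolevNormsOn (Icc 0 T'') u)
    {t : ℝ} (ht : t ∈ Ico 0 T) {r₀ r₁ : ℝ} (hr₀ : 0 < r₀) (hr₁ : r₀ < r₁) {x e : EuclideanSpace ℝ (Fin 3)} (he : ‖e‖ = 1)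
    (hcrit : fderiv ℝ (fun y => ⟪fderiv ℝ (u t) y e, e⟫) x = 0) :
    ⟪timeDerivWithin (Ico 0 T) (fun s y => fderiv ℝ (u s) y e) t x, e⟫ + smoothingTerm r₀ r₁ p t x e
        - ν * strainLap u t x e ≤ newtonNearFeed r₀ r₁ u t x e - strainQuad u t x e ^ 2 := by
  have hsm : ContDiff ℝ ∞ (u t) := hsol.smooth_velocity.contDiff_slice ht
  have hframe := strainFrame_holds ν T hν hT u p hsol t ht x e
  have hE := strainGrowthViscous_holds ν (u t) (p t) hsm x e he hcrit _ hframe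
  have hR := localNewtonSplits_holds ν T u p hν hsol hreg t ht r₀ r₁ hr₀ hr₁ x e
  unfold strainFeed pressureHess at hR
  unfold strainLap strainQuad
  linarith

/-- (SAT) at an exact strain maximiser: the criticality is automatic (Fermat). -/
theorem saturation_law_of_isStrainArgmax {ν T : ℝ} {u : ℝ → (EuclideanSpace ℝ (Fin 3)) → (EuclideanSpace ℝ (Fin 3))}
    {p : ℝ → (EuclideanSpace ℝ (Fin 3)) → ℝ} (hν : 0 < ν) (hT : 0 < T)
    (hsol : IsClassicalNSSolutionOn (Ico 0 T) ν 0 u p) (hreg : ∀ T'' < T, HasBoundedSobolevNormsOn (Icc 0 T'') u)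
    {t : ℝ} (ht : t ∈ Ico 0 T) {r₀ r₁ : ℝ} (hr₀ : 0 < r₀) (hr₁ : r₀ < r₁) {x e : EuclideanSpace ℝ (Fin 3)}
    (hax : IsStrainArgmax u t x e) :
    ⟪timeDerivWithin (Ico 0 T) (fun s y => fderiv ℝ (u s) y e) t x, e⟫ + smoothingTerm r₀ r₁ p t x e
        - ν * strainLap u t x e ≤ newtonNearFeed r₀ r₁ u t x e - strainQuad u t x e ^ 2 := by
  have hloc : IsLocalMax (fun y => strainQuad u t y e) x :=
    Filter.Eventually.of_forall fun y => hax.2 y e hax.1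
  exact saturation_law hν hT hsol hreg ht hr₀ hr₁ hax.1 hloc.fderiv_eq_zero

/-! ## §19 Steady solutions: (★) forces the far field to out-compress viscosity -/

/-- STEADINESS on the frame interval is the hypothesis `∀ s ∈ Ico 0 T, ∀ s' ∈ Ico 0 T, u s = u s'` (spelled out, no new
definition); for a steady velocity the frame's one-sided time derivative of `∇u e` vanishes on `[0,T)`. -/
theorem timeDerivWithin_fderiv_eq_zero_of_steady {T : ℝ} {u : ℝ → (EuclideanSpace ℝ (Fin 3)) → (EuclideanSpace ℝ (Fin 3))}
    (hst : ∀ s ∈ Ico 0 T, ∀ s' ∈ Ico 0 T, u s = u s') {t : ℝ} (ht : t ∈ Ico 0 T) (x e : EuclideanSpace ℝ (Fin 3)) :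
    timeDerivWithin (Ico 0 T) (fun s y => fderiv ℝ (u s) y e) t x = 0 := by
  rw [timeDerivWithin_apply]
  have hEq : EqOn (fun s => fderiv ℝ (u s) x e) (fun _ => fderiv ℝ (u t) x e) (Ico 0 T) := by
    intro s hs
    simp only [hst s hs t ht]
  rw [derivWithin_congr hEq (hEq ht), derivWithin_fun_const]
  rfl

/-- ★ **STEADY SATURATION.** For a STEADY classical solution, at every critical point of the strain form (every exact strain
maximiser in particular) and every pair of scales: `smoothingTerm − ν·strainLap ≤ newtonNearFeed − λ²`. -/
theorem saturation_of_steady {ν T : ℝ} {u : ℝ → (EuclideanSpace ℝ (Fin 3)) → (EuclideanSpace ℝ (Fin 3))}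
    {p : ℝ → (EuclideanSpace ℝ (Fin 3)) → ℝ} (hν : 0 < ν) (hT : 0 < T)
    (hsol : IsClassicalNSSolutionOn (Ico 0 T) ν 0 u p) (hreg : ∀ T'' < T, HasBoundedSobolevNormsOn (Icc 0 T'') u)
    (hst : ∀ s ∈ Ico 0 T, ∀ s' ∈ Ico 0 T, u s = u s') {t : ℝ} (ht : t ∈ Ico 0 T) {r₀ r₁ : ℝ} (hr₀ : 0 < r₀) (hr₁ : r₀ < r₁)
    {x e : EuclideanSpace ℝ (Fin 3)} (he : ‖e‖ = 1) (hcrit : fderiv ℝ (fun y => ⟪fderiv ℝ (u t) y e, e⟫) x = 0) :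
    smoothingTerm r₀ r₁ p t x e - ν * strainLap u t x e ≤ newtonNearFeed r₀ r₁ u t x e - strainQuad u t x e ^ 2 := by
  have h := saturation_law hν hT hsol hreg ht hr₀ hr₁ he hcrit
  rw [timeDerivWithin_fderiv_eq_zero_of_steady hst ht x e, inner_zero_left, zero_add] at h
  exact h

/-- ★ **(★) AT A STEADY MAXIMISER FORCES FAR-FIELD COMPRESSION.**  If a steady classical solution satisfies the D8 parity
`newtonNearFeed ≤ λ²` at an exact strain maximiser `(x,e)`, then there `smoothingTerm ≤ ν·strainLap ≤ 0`: the energy-class far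
field must compress the top strain at least as much as viscosity diffuses the strain form. -/
theorem smoothingTerm_le_of_steady_parity {ν T : ℝ} {u : ℝ → (EuclideanSpace ℝ (Fin 3)) → (EuclideanSpace ℝ (Fin 3))}
    {p : ℝ → (EuclideanSpace ℝ (Fin 3)) → ℝ} (hν : 0 < ν) (hT : 0 < T)
    (hsol : IsClassicalNSSolutionOn (Ico 0 T) ν 0 u p) (hreg : ∀ T'' < T, HasBoundedSobolevNormsOn (Icc 0 T'') u)
    (hst : ∀ s ∈ Ico 0 T, ∀ s' ∈ Ico 0 T, u s = u s') {t : ℝ} (ht : t ∈ Ico 0 T) {r₀ r₁ : ℝ} (hr₀ : 0 < r₀) (hr₁ : r₀ < r₁)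
    {x e : EuclideanSpace ℝ (Fin 3)} (hax : IsStrainArgmax u t x e)
    (hpar : newtonNearFeed r₀ r₁ u t x e ≤ strainQuad u t x e ^ 2) :
    smoothingTerm r₀ r₁ p t x e ≤ ν * strainLap u t x e ∧ ν * strainLap u t x e ≤ 0 := by
  have hsm : ContDiff ℝ ∞ (u t) := hsol.smooth_velocity.contDiff_slice ht
  have hloc : IsLocalMax (fun y => strainQuad u t y e) x :=
    Filter.Eventually.of_forall fun y => hax.2 y e hax.1
  have h := saturation_of_steady hν hT hsol hreg hst ht hr₀ hr₁ hax.1 hloc.fderiv_eq_zero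
  have hlap : strainLap u t x e ≤ 0 := strainLap_nonpos_of_isStrainArgmax hsm hax
  refine ⟨by linarith, ?_⟩
  exact mul_nonpos_iff.2 (Or.inl ⟨hν.le, hlap⟩)

/-- ★ **THE BURGERS SIDE (contrapositive).**  At an exact strain maximiser of a steady classical solution where viscosity
out-diffuses the far field, `ν·strainLap < smoothingTerm` (Burgers vortex, every outer scale `r₁ ≳ 5.5 r_c`:
`ν|strainLap| = α(λ_max + α/2)` while the far-field term tends to `¼α²`), the D8 parity FAILS: `λ² < newtonNearFeed`. -/
theorem not_parity_of_steady {ν T : ℝ} {u : ℝ → (EuclideanSpace ℝ (Fin 3)) → (EuclideanSpace ℝ (Fin 3))}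
    {p : ℝ → (EuclideanSpace ℝ (Fin 3)) → ℝ} (hν : 0 < ν) (hT : 0 < T)
    (hsol : IsClassicalNSSolutionOn (Ico 0 T) ν 0 u p) (hreg : ∀ T'' < T, HasBoundedSobolevNormsOn (Icc 0 T'') u)
    (hst : ∀ s ∈ Ico 0 T, ∀ s' ∈ Ico 0 T, u s = u s') {t : ℝ} (ht : t ∈ Ico 0 T) {r₀ r₁ : ℝ} (hr₀ : 0 < r₀) (hr₁ : r₀ < r₁)
    {x e : EuclideanSpace ℝ (Fin 3)} (he : ‖e‖ = 1) (hcrit : fderiv ℝ (fun y => ⟪fderiv ℝ (u t) y e, e⟫) x = 0)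
    (hvisc : ν * strainLap u t x e < smoothingTerm r₀ r₁ p t x e) :
    strainQuad u t x e ^ 2 < newtonNearFeed r₀ r₁ u t x e := by
  have h := saturation_of_steady hν hT hsol hreg hst ht hr₀ hr₁ he hcrit
  linarith

/-! ## §20 The same law in the fine-structure variables of R46 -/

/-- (SAT) with the near feed written as shape + alignment + ⅓shell − TF (`newtonNearFeed_eq_fineStructureFeed`):
`⟪∂ₜ(∇u e), e⟫ + smoothingTerm − ν·strainLap ≤ fineStructureFeed − λ²`, i.e. the defect of (★)
`[(⅓|S|² − λ²) + ((1/12)|ω|² − ¼ω_e²) + ⅓Λ[q] − TF_ee]` is at least `∂ₜλ + far − ν·strainLap`. -/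
theorem saturation_law_fineStructure {ν T : ℝ} {u : ℝ → (EuclideanSpace ℝ (Fin 3)) → (EuclideanSpace ℝ (Fin 3))}
    {p : ℝ → (EuclideanSpace ℝ (Fin 3)) → ℝ} (hν : 0 < ν) (hT : 0 < T)
    (hsol : IsClassicalNSSolutionOn (Ico 0 T) ν 0 u p) (hreg : ∀ T'' < T, HasBoundedSobolevNormsOn (Icc 0 T'') u)
    {t : ℝ} (ht : t ∈ Ico 0 T) {r₀ r₁ : ℝ} (hr₀ : 0 < r₀) (hr₁ : r₀ < r₁) {x e : EuclideanSpace ℝ (Fin 3)} (he : ‖e‖ = 1)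
    (hcrit : fderiv ℝ (fun y => ⟪fderiv ℝ (u t) y e, e⟫) x = 0) :
    ⟪timeDerivWithin (Ico 0 T) (fun s y => fderiv ℝ (u s) y e) t x, e⟫ + smoothingTerm r₀ r₁ p t x e
        - ν * strainLap u t x e ≤ fineStructureFeed r₀ r₁ u t x e - strainQuad u t x e ^ 2 := by
  rw [← newtonNearFeed_eq_fineStructureFeed hsol ht hr₀ hr₁ x e]
  exact saturation_law hν hT hsol hreg ht hr₀ hr₁ he hcrit

/-- steady twin in the fine-structure variables: `smoothingTerm − ν·strainLap ≤ fineStructureFeed − λ²`. -/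
theorem saturation_of_steady_fineStructure {ν T : ℝ} {u : ℝ → (EuclideanSpace ℝ (Fin 3)) → (EuclideanSpace ℝ (Fin 3))}
    {p : ℝ → (EuclideanSpace ℝ (Fin 3)) → ℝ} (hν : 0 < ν) (hT : 0 < T)
    (hsol : IsClassicalNSSolutionOn (Ico 0 T) ν 0 u p) (hreg : ∀ T'' < T, HasBoundedSobolevNormsOn (Icc 0 T'') u)
    (hst : ∀ s ∈ Ico 0 T, ∀ s' ∈ Ico 0 T, u s = u s') {t : ℝ} (ht : t ∈ Ico 0 T) {r₀ r₁ : ℝ} (hr₀ : 0 < r₀) (hr₁ : r₀ < r₁)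
    {x e : EuclideanSpace ℝ (Fin 3)} (he : ‖e‖ = 1) (hcrit : fderiv ℝ (fun y => ⟪fderiv ℝ (u t) y e, e⟫) x = 0) :
    smoothingTerm r₀ r₁ p t x e - ν * strainLap u t x e ≤ fineStructureFeed r₀ r₁ u t x e - strainQuad u t x e ^ 2 := by
  rw [← newtonNearFeed_eq_fineStructureFeed hsol ht hr₀ hr₁ x e]
  exact saturation_of_steady hν hT hsol hreg hst ht hr₀ hr₁ he hcrit

/-! ## Audit -/
#print axioms saturation_law
#print axioms saturation_of_steady
#print axioms smoothingTerm_le_of_steady_parity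
#print axioms not_parity_of_steady
#print axioms saturation_law_fineStructure

end Summit.NavierStokesRegularity.NavierStokesRegularity.Theorems.StrainDoors

end
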